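import Summits.HodgeConjecture.HodgeConjecture.Theorems.Ring2WeilCoverageWeilGramCMPoint
import Summits.HodgeConjecture.HodgeConjecture.Theorems.Ring2WeilCoverageCyclotomicUnconditional
import Summits.HodgeConjecture.HodgeConjecture.Theorems.Ring2WeilCoverageRealUnitNormHalfSystems
import Summits.HodgeConjecture.HodgeConjecture.Theorems.Ring2WeilCoverageNormTable
import HarnessLib

/-!
# Weil-type family coverage — THE COMPONENTS OF THE WEIL-TYPE `ℤ[ζ₃₃]`-TENFOLDS, I: level lemmas (`Φ₃₃(ζ) = 0` written
# out, the real frame `θ^i`, the skew generators `s₁₁ = 1 + 2(ζ³ + ζ⁹ + ζ¹² + ζ¹⁵ + ζ²⁷) = √−11` and `s₃ = 1 + 2ζ¹¹ = √−3`,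
# the census parameter `ξ = ζ⁹/Φ₃₃′(ζ)`)

research route conditional on HC_CM; not a corollary; Q11.4-sentence-2 already refuted in dim ≥ 3.

Ring 2, WEIL-TYPE FAMILY-COVERAGE CENSUS (`HOME/WEIL-FAMILY-COVERAGE.md` `## b01`, block b01.41 (C) «COMPONENTS (S-pencil,
exact)» at `g = 10` and b01.48 «NEXT: the `g = 10/12` placements»; owner ring2-b01), part 120 of the `Ring2WeilCoverage*`
series: the `g = 10` edition of parts 98/104/109 (`K = ℚ(ζ₃₃)`, `g = 10`, `n = 5`, real frame `xᵢ = θ^i`, `θ = ζ + ζ⁻¹`,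
`i < 10`).  For a skew `ζ′` and a skew `s` with `s² = −d`
part 82 (`Ring2WeilCoverageWeilGramCMPoint`) shows that the Gram matrix `Ψ = a + b√−d` of van Geemen's hermitian form
`H = E(x, sy) + √−d E(x, y)`, `E = E_ζ′ = Tr_{K/ℚ}(ζ′xȳ)`, in a real frame is the rational matrix `a = (−Tr(ζ′s xᵢxⱼ))`,
`b = 0`, with `det a = (−2)^g N_{K⁺/ℚ}(ζ′s) disc(ω)`; for `n = 5` the split class is `[−1]·Nm` and a `Φ`-positive `ζ′` on
a Weil-type (`(5,5)`) CM type has `(−1)⁵ det a > 0`, i.e. `det a < 0` (part 92).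

This file holds only the level lemmas shared by the tenfold Gram files `Ring2WeilCoverageWeilGramLevel33*` (parts 121+):
`Φ₃₃(ζ) = 0` written out, `θ` and the frame `θ^i` are real, `ξ = ζ⁹/Φ₃₃′(ζ)` is skew, `s₁₁² = −11`, `s₃² = −3`, both skew.

HONEST FRAMING as parts 82–118: kernel statements about elements of `ℚ(ζ₃₃)`; nothing about Hodge classes, `W_K`,
general members or HC; `HC_CM` is used nowhere.  No `def`, no named fact, no `sorry`.  Certificates produced by
`work/py/geng.py` + `lev33.py` (exact arithmetic in `ℚ[x]/Φ₃₃`, stdlib) and re-verified here by `linear_combination`.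

References: [cite: vanGeemen1994HodgeAV, Lemma 5.2 (2)–(4)]; [cite: Shimura1998, §14.3 Prop. 4–5, pp. 103–104]; [folklore].
-/

noncomputable section

open Polynomial NumberField Module
open scoped nonZeroDivisors

namespace Summit.HodgeConjecture.Ring2WeilCoverage.WeilGramLevel33

open Literature.NumberTheory.ComplexMultiplication
open Summit.HodgeConjecture.Ring2WeilCoverage.RealUnitNormHalfSystems (complexConj_eq_inv)
open Summit.HodgeConjecture.Ring2WeilCoverage.CyclotomicPrincipalObstruction (complexConj_xi)
variable {K : Type} [Field K] [NumberField K] {ζ : K}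

/-! ### §0 Level lemmas -/

omit [NumberField K] in
/-- **`Φ₃₃(ζ) = 0` written out** (`(x¹¹ − 1)(x² + x + 1)Φ₃₃(x) = x³³ − 1`, `ζ¹¹ ≠ 1`, `ζ³ ≠ 1`). research route conditional on HC_CM; not a corollary; Q11.4-sentence-2 already refuted in dim ≥ 3. [folklore] -/
theorem cyc_thirtyThree (hζ : IsPrimitiveRoot ζ 33) :
    ζ ^ 20 - ζ ^ 19 + ζ ^ 17 - ζ ^ 16 + ζ ^ 14 - ζ ^ 13 + ζ ^ 11 - ζ ^ 10 + ζ ^ 9 - ζ ^ 7 + ζ ^ 6 - ζ ^ 4 + ζ ^ 3 - ζ + 1 = 0 := by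
  have h33 : ζ ^ 33 = 1 := hζ.pow_eq_one
  have h11 : ζ ^ 11 - 1 ≠ 0 := sub_ne_zero.mpr (hζ.pow_ne_one_of_pos_of_lt (by norm_num) (by norm_num))
  have h3 : ζ ^ 3 ≠ 1 := hζ.pow_ne_one_of_pos_of_lt (by norm_num) (by norm_num)
  have h2 : ζ ^ 2 + ζ + 1 ≠ 0 := by
    intro h
    apply h3
    linear_combination (ζ - 1) * h
  have h : (ζ ^ 11 - 1) * (ζ ^ 2 + ζ + 1) *
      (ζ ^ 20 - ζ ^ 19 + ζ ^ 17 - ζ ^ 16 + ζ ^ 14 - ζ ^ 13 + ζ ^ 11 - ζ ^ 10 + ζ ^ 9 - ζ ^ 7 + ζ ^ 6 - ζ ^ 4 + ζ ^ 3 - ζ + 1) = 0 := by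
    linear_combination h33
  rcases mul_eq_zero.mp h with h' | h'
  · exact absurd h' (mul_ne_zero h11 h2)
  · exact h'

omit [NumberField K] in
/-- `(ζ⁻¹)^a = ζ^b` when `a + b = 33`. [folklore] -/
theorem inv_pow_eq_pow (hζ : IsPrimitiveRoot ζ 33) {a b : ℕ} (hab : a + b = 33) : ζ⁻¹ ^ a = ζ ^ b := by
  rw [inv_pow]
  apply inv_eq_of_mul_eq_one_right
  rw [← pow_add, hab, hζ.pow_eq_one]

/-- `θ = ζ + ζ⁻¹` is real. [folklore] -/
theorem complexConj_theta [IsCMField K] (hζ : IsPrimitiveRoot ζ 33) :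
    IsCMField.complexConj K (ζ + ζ⁻¹) = ζ + ζ⁻¹ := by
  rw [map_add, map_inv₀, complexConj_eq_inv hζ, inv_inv, add_comm]

/-- The frame `xᵢ = θ^i` is real. [folklore] -/
theorem complexConj_thetaFrame [IsCMField K] (hζ : IsPrimitiveRoot ζ 33) {m : ℕ} {x : Fin m → K}
    (hx : ∀ i, x i = (ζ + ζ⁻¹) ^ (i : ℕ)) (i : Fin m) : IsCMField.complexConj K (x i) = x i := by
  rw [hx i, map_pow, complexConj_theta hζ]

/-- `ξ = ζ^9/Φ′(ζ)` is skew (part 7, `g − 1 = 9`). [folklore] -/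
theorem complexConj_xi_thirtyThree [IsCMField K] (hζ : IsPrimitiveRoot ζ 33) :
    IsCMField.complexConj K (ζ ^ 9 * (aeval ζ (derivative (cyclotomic 33 ℚ)))⁻¹) =
      -(ζ ^ 9 * (aeval ζ (derivative (cyclotomic 33 ℚ)))⁻¹) :=
  complexConj_xi hζ (k := 9) (by decide)

/-! ### §1 The skew generators `s₁₁ = √−11` and `s₃ = √−3` -/

omit [NumberField K] in
/-- **`(1 + 2(ζ³ + ζ⁹ + ζ¹² + ζ¹⁵ + ζ²⁷))² = −11`**: `s = √−11 = 1 + 2(ζ³ + ζ⁹ + ζ¹² + ζ¹⁵ + ζ²⁷)` generates `K_d = ℚ(√−11) ⊂ ℚ(ζ_33)`. [folklore] -/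
theorem sq_sqrtNegEleven (hζ : IsPrimitiveRoot ζ 33) : (1 + 2 * (ζ ^ 3 + ζ ^ 9 + ζ ^ 12 + ζ ^ 15 + ζ ^ 27)) ^ 2 = -11 := by
  have h33 : ζ ^ 33 = 1 := hζ.pow_eq_one
  linear_combination (12 + 12 * ζ + 12 * ζ^2 + 12 * ζ^3 + 12 * ζ^4 + 12 * ζ^5 + 12 * ζ^6 + 12 * ζ^7 + 12 * ζ^8 + 12 * ζ^9 + 12 * ζ^10) * cyc_thirtyThree hζ +
    (8 * ζ^3 + 8 * ζ^6 + 8 * ζ^9 + 4 * ζ^21) * h33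

/-- **`s = √−11 = 1 + 2(ζ³ + ζ⁹ + ζ¹² + ζ¹⁵ + ζ²⁷)` is skew** (`s^ρ = −s`). [folklore] -/
theorem complexConj_sqrtNegEleven [IsCMField K] (hζ : IsPrimitiveRoot ζ 33) :
    IsCMField.complexConj K (1 + 2 * (ζ ^ 3 + ζ ^ 9 + ζ ^ 12 + ζ ^ 15 + ζ ^ 27)) = -(1 + 2 * (ζ ^ 3 + ζ ^ 9 + ζ ^ 12 + ζ ^ 15 + ζ ^ 27)) := by
  simp only [map_add, map_mul, map_pow, map_one, map_ofNat, complexConj_eq_inv hζ]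
  rw [inv_pow_eq_pow hζ (show 3 + 30 = 33 by norm_num), inv_pow_eq_pow hζ (show 9 + 24 = 33 by norm_num), inv_pow_eq_pow hζ (show 12 + 21 = 33 by norm_num), inv_pow_eq_pow hζ (show 15 + 18 = 33 by norm_num), inv_pow_eq_pow hζ (show 27 + 6 = 33 by norm_num)]
  linear_combination (2 + 2 * ζ + 2 * ζ^2 + 2 * ζ^3 + 2 * ζ^4 + 2 * ζ^5 + 2 * ζ^6 + 2 * ζ^7 + 2 * ζ^8 + 2 * ζ^9 + 2 * ζ^10) * cyc_thirtyThree hζ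

omit [NumberField K] in
/-- **`(1 + 2ζ¹¹)² = −3`**: `s = √−3 = 1 + 2ζ¹¹` generates `K_d = ℚ(√−3) ⊂ ℚ(ζ_33)`. [folklore] -/
theorem sq_sqrtNegThree (hζ : IsPrimitiveRoot ζ 33) : (1 + 2 * ζ ^ 11) ^ 2 = -3 := by
  linear_combination (4 + 4 * ζ + 4 * ζ^2) * cyc_thirtyThree hζ

/-- **`s = √−3 = 1 + 2ζ¹¹` is skew** (`s^ρ = −s`). [folklore] -/
theorem complexConj_sqrtNegThree [IsCMField K] (hζ : IsPrimitiveRoot ζ 33) :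
    IsCMField.complexConj K (1 + 2 * ζ ^ 11) = -(1 + 2 * ζ ^ 11) := by
  simp only [map_add, map_mul, map_pow, map_one, map_ofNat, complexConj_eq_inv hζ]
  rw [inv_pow_eq_pow hζ (show 11 + 22 = 33 by norm_num)]
  linear_combination (2 + 2 * ζ + 2 * ζ^2) * cyc_thirtyThree hζ

/-! ### §2 `θ^10` on the frame and the trace recurrence -/

/-- **`θ^10` on the frame**: the minimal polynomial of `θ = ζ + ζ⁻¹` over `ℚ` (`Φ_33(x) = x^10ψ(x + x⁻¹)`), i.e.
`θ^10 = -1 + 12 * θ - 12 * θ ^ 2 - 43 * θ ^ 3 + 43 * θ ^ 4 + 34 * θ ^ 5 - 34 * θ ^ 6 - 10 * θ ^ 7 + 10 * θ ^ 8 + θ ^ 9`. research route conditional on HC_CM; not a corollary; Q11.4-sentence-2 already refuted in dim ≥ 3. [folklore] -/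
theorem theta_pow_ten (hζ : IsPrimitiveRoot ζ 33) :
    (ζ + ζ⁻¹) ^ 10 = -1 + 12 * (ζ + ζ⁻¹) - 12 * (ζ + ζ⁻¹) ^ 2 - 43 * (ζ + ζ⁻¹) ^ 3 + 43 * (ζ + ζ⁻¹) ^ 4 + 34 * (ζ + ζ⁻¹) ^ 5 -
      34 * (ζ + ζ⁻¹) ^ 6 - 10 * (ζ + ζ⁻¹) ^ 7 + 10 * (ζ + ζ⁻¹) ^ 8 + (ζ + ζ⁻¹) ^ 9 := by
  have hζ0 : ζ ≠ 0 := hζ.ne_zero (by norm_num)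
  have hΦ := cyc_thirtyThree hζ
  have hθ : (ζ + ζ⁻¹) * ζ = ζ ^ 2 + 1 := by rw [add_mul, inv_mul_cancel₀ hζ0]; ring
  apply mul_right_cancel₀ (pow_ne_zero 10 hζ0)
  calc (ζ + ζ⁻¹) ^ 10 * ζ ^ 10 = ((ζ + ζ⁻¹) * ζ) ^ 10 := by ring
    _ = (ζ ^ 2 + 1) ^ 10 := by rw [hθ]
    _ = -ζ ^ 10 + 12 * (ζ ^ 2 + 1) * ζ ^ 9 - 12 * (ζ ^ 2 + 1) ^ 2 * ζ ^ 8 - 43 * (ζ ^ 2 + 1) ^ 3 * ζ ^ 7 +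
        43 * (ζ ^ 2 + 1) ^ 4 * ζ ^ 6 + 34 * (ζ ^ 2 + 1) ^ 5 * ζ ^ 5 - 34 * (ζ ^ 2 + 1) ^ 6 * ζ ^ 4 -
        10 * (ζ ^ 2 + 1) ^ 7 * ζ ^ 3 + 10 * (ζ ^ 2 + 1) ^ 8 * ζ ^ 2 + (ζ ^ 2 + 1) ^ 9 * ζ := by
      linear_combination hΦ
    _ = -ζ ^ 10 + 12 * ((ζ + ζ⁻¹) * ζ) * ζ ^ 9 - 12 * ((ζ + ζ⁻¹) * ζ) ^ 2 * ζ ^ 8 -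
        43 * ((ζ + ζ⁻¹) * ζ) ^ 3 * ζ ^ 7 + 43 * ((ζ + ζ⁻¹) * ζ) ^ 4 * ζ ^ 6 + 34 * ((ζ + ζ⁻¹) * ζ) ^ 5 * ζ ^ 5 -
        34 * ((ζ + ζ⁻¹) * ζ) ^ 6 * ζ ^ 4 - 10 * ((ζ + ζ⁻¹) * ζ) ^ 7 * ζ ^ 3 + 10 * ((ζ + ζ⁻¹) * ζ) ^ 8 * ζ ^ 2 +
        ((ζ + ζ⁻¹) * ζ) ^ 9 * ζ := by
      rw [hθ]
    _ = (-1 + 12 * (ζ + ζ⁻¹) - 12 * (ζ + ζ⁻¹) ^ 2 - 43 * (ζ + ζ⁻¹) ^ 3 + 43 * (ζ + ζ⁻¹) ^ 4 + 34 * (ζ + ζ⁻¹) ^ 5 -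
        34 * (ζ + ζ⁻¹) ^ 6 - 10 * (ζ + ζ⁻¹) ^ 7 + 10 * (ζ + ζ⁻¹) ^ 8 + (ζ + ζ⁻¹) ^ 9) * ζ ^ 10 := by
      ring

/-- The trace recurrence at `θ^10`: `Tr(y·θ^10) = Σ eₖ·Tr(y·θ^{0+k})` from `θ^10 = Σ eₖ θ^k`. [folklore] -/
theorem trace_mul_theta_pow_ten (hζ : IsPrimitiveRoot ζ 33) (y : K) :
    Algebra.trace ℚ K (y * (ζ + ζ⁻¹) ^ 10) =
      (-1) * Algebra.trace ℚ K (y) + 12 * Algebra.trace ℚ K (y * (ζ + ζ⁻¹)) +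
      (-12) * Algebra.trace ℚ K (y * (ζ + ζ⁻¹) ^ 2) + (-43) * Algebra.trace ℚ K (y * (ζ + ζ⁻¹) ^ 3) +
      43 * Algebra.trace ℚ K (y * (ζ + ζ⁻¹) ^ 4) + 34 * Algebra.trace ℚ K (y * (ζ + ζ⁻¹) ^ 5) +
      (-34) * Algebra.trace ℚ K (y * (ζ + ζ⁻¹) ^ 6) + (-10) * Algebra.trace ℚ K (y * (ζ + ζ⁻¹) ^ 7) +
      10 * Algebra.trace ℚ K (y * (ζ + ζ⁻¹) ^ 8) + 1 * Algebra.trace ℚ K (y * (ζ + ζ⁻¹) ^ 9) := by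
  have e : y * (ζ + ζ⁻¹) ^ 10 =
      (-1 : ℚ) • (y) + (12 : ℚ) • (y * (ζ + ζ⁻¹)) + (-12 : ℚ) • (y * (ζ + ζ⁻¹) ^ 2) +
      (-43 : ℚ) • (y * (ζ + ζ⁻¹) ^ 3) + (43 : ℚ) • (y * (ζ + ζ⁻¹) ^ 4) + (34 : ℚ) • (y * (ζ + ζ⁻¹) ^ 5) +
      (-34 : ℚ) • (y * (ζ + ζ⁻¹) ^ 6) + (-10 : ℚ) • (y * (ζ + ζ⁻¹) ^ 7) + (10 : ℚ) • (y * (ζ + ζ⁻¹) ^ 8) +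
      (1 : ℚ) • (y * (ζ + ζ⁻¹) ^ 9) := by
    conv_lhs => rw [theta_pow_ten hζ]
    simp only [Rat.smul_def]
    push_cast
    ring
  rw [e]
  simp only [map_add, map_smul, smul_eq_mul]

/-- The trace recurrence at `θ^11`: `Tr(y·θ^11) = Σ eₖ·Tr(y·θ^{1+k})` from `θ^10 = Σ eₖ θ^k`. [folklore] -/
theorem trace_mul_theta_pow_eleven (hζ : IsPrimitiveRoot ζ 33) (y : K) :
    Algebra.trace ℚ K (y * (ζ + ζ⁻¹) ^ 11) =
      (-1) * Algebra.trace ℚ K (y * (ζ + ζ⁻¹)) + 12 * Algebra.trace ℚ K (y * (ζ + ζ⁻¹) ^ 2) +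
      (-12) * Algebra.trace ℚ K (y * (ζ + ζ⁻¹) ^ 3) + (-43) * Algebra.trace ℚ K (y * (ζ + ζ⁻¹) ^ 4) +
      43 * Algebra.trace ℚ K (y * (ζ + ζ⁻¹) ^ 5) + 34 * Algebra.trace ℚ K (y * (ζ + ζ⁻¹) ^ 6) +
      (-34) * Algebra.trace ℚ K (y * (ζ + ζ⁻¹) ^ 7) + (-10) * Algebra.trace ℚ K (y * (ζ + ζ⁻¹) ^ 8) +
      10 * Algebra.trace ℚ K (y * (ζ + ζ⁻¹) ^ 9) + 1 * Algebra.trace ℚ K (y * (ζ + ζ⁻¹) ^ 10) := by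
  have e : y * (ζ + ζ⁻¹) ^ 11 =
      (-1 : ℚ) • (y * (ζ + ζ⁻¹)) + (12 : ℚ) • (y * (ζ + ζ⁻¹) ^ 2) + (-12 : ℚ) • (y * (ζ + ζ⁻¹) ^ 3) +
      (-43 : ℚ) • (y * (ζ + ζ⁻¹) ^ 4) + (43 : ℚ) • (y * (ζ + ζ⁻¹) ^ 5) + (34 : ℚ) • (y * (ζ + ζ⁻¹) ^ 6) +
      (-34 : ℚ) • (y * (ζ + ζ⁻¹) ^ 7) + (-10 : ℚ) • (y * (ζ + ζ⁻¹) ^ 8) + (10 : ℚ) • (y * (ζ + ζ⁻¹) ^ 9) +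
      (1 : ℚ) • (y * (ζ + ζ⁻¹) ^ 10) := by
    conv_lhs => rw [show y * (ζ + ζ⁻¹) ^ 11 = y * (ζ + ζ⁻¹) * (ζ + ζ⁻¹) ^ 10 by ring, theta_pow_ten hζ]
    simp only [Rat.smul_def]
    push_cast
    ring
  rw [e]
  simp only [map_add, map_smul, smul_eq_mul]

/-- The trace recurrence at `θ^12`: `Tr(y·θ^12) = Σ eₖ·Tr(y·θ^{2+k})` from `θ^10 = Σ eₖ θ^k`. [folklore] -/
theorem trace_mul_theta_pow_twelve (hζ : IsPrimitiveRoot ζ 33) (y : K) :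
    Algebra.trace ℚ K (y * (ζ + ζ⁻¹) ^ 12) =
      (-1) * Algebra.trace ℚ K (y * (ζ + ζ⁻¹) ^ 2) + 12 * Algebra.trace ℚ K (y * (ζ + ζ⁻¹) ^ 3) +
      (-12) * Algebra.trace ℚ K (y * (ζ + ζ⁻¹) ^ 4) + (-43) * Algebra.trace ℚ K (y * (ζ + ζ⁻¹) ^ 5) +
      43 * Algebra.trace ℚ K (y * (ζ + ζ⁻¹) ^ 6) + 34 * Algebra.trace ℚ K (y * (ζ + ζ⁻¹) ^ 7) +
      (-34) * Algebra.trace ℚ K (y * (ζ + ζ⁻¹) ^ 8) + (-10) * Algebra.trace ℚ K (y * (ζ + ζ⁻¹) ^ 9) +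
      10 * Algebra.trace ℚ K (y * (ζ + ζ⁻¹) ^ 10) + 1 * Algebra.trace ℚ K (y * (ζ + ζ⁻¹) ^ 11) := by
  have e : y * (ζ + ζ⁻¹) ^ 12 =
      (-1 : ℚ) • (y * (ζ + ζ⁻¹) ^ 2) + (12 : ℚ) • (y * (ζ + ζ⁻¹) ^ 3) + (-12 : ℚ) • (y * (ζ + ζ⁻¹) ^ 4) +
      (-43 : ℚ) • (y * (ζ + ζ⁻¹) ^ 5) + (43 : ℚ) • (y * (ζ + ζ⁻¹) ^ 6) + (34 : ℚ) • (y * (ζ + ζ⁻¹) ^ 7) +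
      (-34 : ℚ) • (y * (ζ + ζ⁻¹) ^ 8) + (-10 : ℚ) • (y * (ζ + ζ⁻¹) ^ 9) + (10 : ℚ) • (y * (ζ + ζ⁻¹) ^ 10) +
      (1 : ℚ) • (y * (ζ + ζ⁻¹) ^ 11) := by
    conv_lhs => rw [show y * (ζ + ζ⁻¹) ^ 12 = y * (ζ + ζ⁻¹) ^ 2 * (ζ + ζ⁻¹) ^ 10 by ring, theta_pow_ten hζ]
    simp only [Rat.smul_def]
    push_cast
    ring
  rw [e]
  simp only [map_add, map_smul, smul_eq_mul]

/-- The trace recurrence at `θ^13`: `Tr(y·θ^13) = Σ eₖ·Tr(y·θ^{3+k})` from `θ^10 = Σ eₖ θ^k`. [folklore] -/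
theorem trace_mul_theta_pow_thirteen (hζ : IsPrimitiveRoot ζ 33) (y : K) :
    Algebra.trace ℚ K (y * (ζ + ζ⁻¹) ^ 13) =
      (-1) * Algebra.trace ℚ K (y * (ζ + ζ⁻¹) ^ 3) + 12 * Algebra.trace ℚ K (y * (ζ + ζ⁻¹) ^ 4) +
      (-12) * Algebra.trace ℚ K (y * (ζ + ζ⁻¹) ^ 5) + (-43) * Algebra.trace ℚ K (y * (ζ + ζ⁻¹) ^ 6) +
      43 * Algebra.trace ℚ K (y * (ζ + ζ⁻¹) ^ 7) + 34 * Algebra.trace ℚ K (y * (ζ + ζ⁻¹) ^ 8) +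
      (-34) * Algebra.trace ℚ K (y * (ζ + ζ⁻¹) ^ 9) + (-10) * Algebra.trace ℚ K (y * (ζ + ζ⁻¹) ^ 10) +
      10 * Algebra.trace ℚ K (y * (ζ + ζ⁻¹) ^ 11) + 1 * Algebra.trace ℚ K (y * (ζ + ζ⁻¹) ^ 12) := by
  have e : y * (ζ + ζ⁻¹) ^ 13 =
      (-1 : ℚ) • (y * (ζ + ζ⁻¹) ^ 3) + (12 : ℚ) • (y * (ζ + ζ⁻¹) ^ 4) + (-12 : ℚ) • (y * (ζ + ζ⁻¹) ^ 5) +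
      (-43 : ℚ) • (y * (ζ + ζ⁻¹) ^ 6) + (43 : ℚ) • (y * (ζ + ζ⁻¹) ^ 7) + (34 : ℚ) • (y * (ζ + ζ⁻¹) ^ 8) +
      (-34 : ℚ) • (y * (ζ + ζ⁻¹) ^ 9) + (-10 : ℚ) • (y * (ζ + ζ⁻¹) ^ 10) + (10 : ℚ) • (y * (ζ + ζ⁻¹) ^ 11) +
      (1 : ℚ) • (y * (ζ + ζ⁻¹) ^ 12) := by
    conv_lhs => rw [show y * (ζ + ζ⁻¹) ^ 13 = y * (ζ + ζ⁻¹) ^ 3 * (ζ + ζ⁻¹) ^ 10 by ring, theta_pow_ten hζ]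
    simp only [Rat.smul_def]
    push_cast
    ring
  rw [e]
  simp only [map_add, map_smul, smul_eq_mul]

/-- The trace recurrence at `θ^14`: `Tr(y·θ^14) = Σ eₖ·Tr(y·θ^{4+k})` from `θ^10 = Σ eₖ θ^k`. [folklore] -/
theorem trace_mul_theta_pow_fourteen (hζ : IsPrimitiveRoot ζ 33) (y : K) :
    Algebra.trace ℚ K (y * (ζ + ζ⁻¹) ^ 14) =
      (-1) * Algebra.trace ℚ K (y * (ζ + ζ⁻¹) ^ 4) + 12 * Algebra.trace ℚ K (y * (ζ + ζ⁻¹) ^ 5) +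
      (-12) * Algebra.trace ℚ K (y * (ζ + ζ⁻¹) ^ 6) + (-43) * Algebra.trace ℚ K (y * (ζ + ζ⁻¹) ^ 7) +
      43 * Algebra.trace ℚ K (y * (ζ + ζ⁻¹) ^ 8) + 34 * Algebra.trace ℚ K (y * (ζ + ζ⁻¹) ^ 9) +
      (-34) * Algebra.trace ℚ K (y * (ζ + ζ⁻¹) ^ 10) + (-10) * Algebra.trace ℚ K (y * (ζ + ζ⁻¹) ^ 11) +
      10 * Algebra.trace ℚ K (y * (ζ + ζ⁻¹) ^ 12) + 1 * Algebra.trace ℚ K (y * (ζ + ζ⁻¹) ^ 13) := by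
  have e : y * (ζ + ζ⁻¹) ^ 14 =
      (-1 : ℚ) • (y * (ζ + ζ⁻¹) ^ 4) + (12 : ℚ) • (y * (ζ + ζ⁻¹) ^ 5) + (-12 : ℚ) • (y * (ζ + ζ⁻¹) ^ 6) +
      (-43 : ℚ) • (y * (ζ + ζ⁻¹) ^ 7) + (43 : ℚ) • (y * (ζ + ζ⁻¹) ^ 8) + (34 : ℚ) • (y * (ζ + ζ⁻¹) ^ 9) +
      (-34 : ℚ) • (y * (ζ + ζ⁻¹) ^ 10) + (-10 : ℚ) • (y * (ζ + ζ⁻¹) ^ 11) + (10 : ℚ) • (y * (ζ + ζ⁻¹) ^ 12) +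
      (1 : ℚ) • (y * (ζ + ζ⁻¹) ^ 13) := by
    conv_lhs => rw [show y * (ζ + ζ⁻¹) ^ 14 = y * (ζ + ζ⁻¹) ^ 4 * (ζ + ζ⁻¹) ^ 10 by ring, theta_pow_ten hζ]
    simp only [Rat.smul_def]
    push_cast
    ring
  rw [e]
  simp only [map_add, map_smul, smul_eq_mul]

/-- The trace recurrence at `θ^15`: `Tr(y·θ^15) = Σ eₖ·Tr(y·θ^{5+k})` from `θ^10 = Σ eₖ θ^k`. [folklore] -/
theorem trace_mul_theta_pow_fifteen (hζ : IsPrimitiveRoot ζ 33) (y : K) :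
    Algebra.trace ℚ K (y * (ζ + ζ⁻¹) ^ 15) =
      (-1) * Algebra.trace ℚ K (y * (ζ + ζ⁻¹) ^ 5) + 12 * Algebra.trace ℚ K (y * (ζ + ζ⁻¹) ^ 6) +
      (-12) * Algebra.trace ℚ K (y * (ζ + ζ⁻¹) ^ 7) + (-43) * Algebra.trace ℚ K (y * (ζ + ζ⁻¹) ^ 8) +
      43 * Algebra.trace ℚ K (y * (ζ + ζ⁻¹) ^ 9) + 34 * Algebra.trace ℚ K (y * (ζ + ζ⁻¹) ^ 10) +
      (-34) * Algebra.trace ℚ K (y * (ζ + ζ⁻¹) ^ 11) + (-10) * Algebra.trace ℚ K (y * (ζ + ζ⁻¹) ^ 12) +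
      10 * Algebra.trace ℚ K (y * (ζ + ζ⁻¹) ^ 13) + 1 * Algebra.trace ℚ K (y * (ζ + ζ⁻¹) ^ 14) := by
  have e : y * (ζ + ζ⁻¹) ^ 15 =
      (-1 : ℚ) • (y * (ζ + ζ⁻¹) ^ 5) + (12 : ℚ) • (y * (ζ + ζ⁻¹) ^ 6) + (-12 : ℚ) • (y * (ζ + ζ⁻¹) ^ 7) +
      (-43 : ℚ) • (y * (ζ + ζ⁻¹) ^ 8) + (43 : ℚ) • (y * (ζ + ζ⁻¹) ^ 9) + (34 : ℚ) • (y * (ζ + ζ⁻¹) ^ 10) +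
      (-34 : ℚ) • (y * (ζ + ζ⁻¹) ^ 11) + (-10 : ℚ) • (y * (ζ + ζ⁻¹) ^ 12) + (10 : ℚ) • (y * (ζ + ζ⁻¹) ^ 13) +
      (1 : ℚ) • (y * (ζ + ζ⁻¹) ^ 14) := by
    conv_lhs => rw [show y * (ζ + ζ⁻¹) ^ 15 = y * (ζ + ζ⁻¹) ^ 5 * (ζ + ζ⁻¹) ^ 10 by ring, theta_pow_ten hζ]
    simp only [Rat.smul_def]
    push_cast
    ring
  rw [e]
  simp only [map_add, map_smul, smul_eq_mul]

/-- The trace recurrence at `θ^16`: `Tr(y·θ^16) = Σ eₖ·Tr(y·θ^{6+k})` from `θ^10 = Σ eₖ θ^k`. [folklore] -/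
theorem trace_mul_theta_pow_sixteen (hζ : IsPrimitiveRoot ζ 33) (y : K) :
    Algebra.trace ℚ K (y * (ζ + ζ⁻¹) ^ 16) =
      (-1) * Algebra.trace ℚ K (y * (ζ + ζ⁻¹) ^ 6) + 12 * Algebra.trace ℚ K (y * (ζ + ζ⁻¹) ^ 7) +
      (-12) * Algebra.trace ℚ K (y * (ζ + ζ⁻¹) ^ 8) + (-43) * Algebra.trace ℚ K (y * (ζ + ζ⁻¹) ^ 9) +
      43 * Algebra.trace ℚ K (y * (ζ + ζ⁻¹) ^ 10) + 34 * Algebra.trace ℚ K (y * (ζ + ζ⁻¹) ^ 11) +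
      (-34) * Algebra.trace ℚ K (y * (ζ + ζ⁻¹) ^ 12) + (-10) * Algebra.trace ℚ K (y * (ζ + ζ⁻¹) ^ 13) +
      10 * Algebra.trace ℚ K (y * (ζ + ζ⁻¹) ^ 14) + 1 * Algebra.trace ℚ K (y * (ζ + ζ⁻¹) ^ 15) := by
  have e : y * (ζ + ζ⁻¹) ^ 16 =
      (-1 : ℚ) • (y * (ζ + ζ⁻¹) ^ 6) + (12 : ℚ) • (y * (ζ + ζ⁻¹) ^ 7) + (-12 : ℚ) • (y * (ζ + ζ⁻¹) ^ 8) +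
      (-43 : ℚ) • (y * (ζ + ζ⁻¹) ^ 9) + (43 : ℚ) • (y * (ζ + ζ⁻¹) ^ 10) + (34 : ℚ) • (y * (ζ + ζ⁻¹) ^ 11) +
      (-34 : ℚ) • (y * (ζ + ζ⁻¹) ^ 12) + (-10 : ℚ) • (y * (ζ + ζ⁻¹) ^ 13) + (10 : ℚ) • (y * (ζ + ζ⁻¹) ^ 14) +
      (1 : ℚ) • (y * (ζ + ζ⁻¹) ^ 15) := by
    conv_lhs => rw [show y * (ζ + ζ⁻¹) ^ 16 = y * (ζ + ζ⁻¹) ^ 6 * (ζ + ζ⁻¹) ^ 10 by ring, theta_pow_ten hζ]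
    simp only [Rat.smul_def]
    push_cast
    ring
  rw [e]
  simp only [map_add, map_smul, smul_eq_mul]

/-- The trace recurrence at `θ^17`: `Tr(y·θ^17) = Σ eₖ·Tr(y·θ^{7+k})` from `θ^10 = Σ eₖ θ^k`. [folklore] -/
theorem trace_mul_theta_pow_seventeen (hζ : IsPrimitiveRoot ζ 33) (y : K) :
    Algebra.trace ℚ K (y * (ζ + ζ⁻¹) ^ 17) =
      (-1) * Algebra.trace ℚ K (y * (ζ + ζ⁻¹) ^ 7) + 12 * Algebra.trace ℚ K (y * (ζ + ζ⁻¹) ^ 8) +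
      (-12) * Algebra.trace ℚ K (y * (ζ + ζ⁻¹) ^ 9) + (-43) * Algebra.trace ℚ K (y * (ζ + ζ⁻¹) ^ 10) +
      43 * Algebra.trace ℚ K (y * (ζ + ζ⁻¹) ^ 11) + 34 * Algebra.trace ℚ K (y * (ζ + ζ⁻¹) ^ 12) +
      (-34) * Algebra.trace ℚ K (y * (ζ + ζ⁻¹) ^ 13) + (-10) * Algebra.trace ℚ K (y * (ζ + ζ⁻¹) ^ 14) +
      10 * Algebra.trace ℚ K (y * (ζ + ζ⁻¹) ^ 15) + 1 * Algebra.trace ℚ K (y * (ζ + ζ⁻¹) ^ 16) := by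
  have e : y * (ζ + ζ⁻¹) ^ 17 =
      (-1 : ℚ) • (y * (ζ + ζ⁻¹) ^ 7) + (12 : ℚ) • (y * (ζ + ζ⁻¹) ^ 8) + (-12 : ℚ) • (y * (ζ + ζ⁻¹) ^ 9) +
      (-43 : ℚ) • (y * (ζ + ζ⁻¹) ^ 10) + (43 : ℚ) • (y * (ζ + ζ⁻¹) ^ 11) + (34 : ℚ) • (y * (ζ + ζ⁻¹) ^ 12) +
      (-34 : ℚ) • (y * (ζ + ζ⁻¹) ^ 13) + (-10 : ℚ) • (y * (ζ + ζ⁻¹) ^ 14) + (10 : ℚ) • (y * (ζ + ζ⁻¹) ^ 15) +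
      (1 : ℚ) • (y * (ζ + ζ⁻¹) ^ 16) := by
    conv_lhs => rw [show y * (ζ + ζ⁻¹) ^ 17 = y * (ζ + ζ⁻¹) ^ 7 * (ζ + ζ⁻¹) ^ 10 by ring, theta_pow_ten hζ]
    simp only [Rat.smul_def]
    push_cast
    ring
  rw [e]
  simp only [map_add, map_smul, smul_eq_mul]

/-- The trace recurrence at `θ^18`: `Tr(y·θ^18) = Σ eₖ·Tr(y·θ^{8+k})` from `θ^10 = Σ eₖ θ^k`. [folklore] -/
theorem trace_mul_theta_pow_eighteen (hζ : IsPrimitiveRoot ζ 33) (y : K) :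
    Algebra.trace ℚ K (y * (ζ + ζ⁻¹) ^ 18) =
      (-1) * Algebra.trace ℚ K (y * (ζ + ζ⁻¹) ^ 8) + 12 * Algebra.trace ℚ K (y * (ζ + ζ⁻¹) ^ 9) +
      (-12) * Algebra.trace ℚ K (y * (ζ + ζ⁻¹) ^ 10) + (-43) * Algebra.trace ℚ K (y * (ζ + ζ⁻¹) ^ 11) +
      43 * Algebra.trace ℚ K (y * (ζ + ζ⁻¹) ^ 12) + 34 * Algebra.trace ℚ K (y * (ζ + ζ⁻¹) ^ 13) +
      (-34) * Algebra.trace ℚ K (y * (ζ + ζ⁻¹) ^ 14) + (-10) * Algebra.trace ℚ K (y * (ζ + ζ⁻¹) ^ 15) +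
      10 * Algebra.trace ℚ K (y * (ζ + ζ⁻¹) ^ 16) + 1 * Algebra.trace ℚ K (y * (ζ + ζ⁻¹) ^ 17) := by
  have e : y * (ζ + ζ⁻¹) ^ 18 =
      (-1 : ℚ) • (y * (ζ + ζ⁻¹) ^ 8) + (12 : ℚ) • (y * (ζ + ζ⁻¹) ^ 9) + (-12 : ℚ) • (y * (ζ + ζ⁻¹) ^ 10) +
      (-43 : ℚ) • (y * (ζ + ζ⁻¹) ^ 11) + (43 : ℚ) • (y * (ζ + ζ⁻¹) ^ 12) + (34 : ℚ) • (y * (ζ + ζ⁻¹) ^ 13) +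
      (-34 : ℚ) • (y * (ζ + ζ⁻¹) ^ 14) + (-10 : ℚ) • (y * (ζ + ζ⁻¹) ^ 15) + (10 : ℚ) • (y * (ζ + ζ⁻¹) ^ 16) +
      (1 : ℚ) • (y * (ζ + ζ⁻¹) ^ 17) := by
    conv_lhs => rw [show y * (ζ + ζ⁻¹) ^ 18 = y * (ζ + ζ⁻¹) ^ 8 * (ζ + ζ⁻¹) ^ 10 by ring, theta_pow_ten hζ]
    simp only [Rat.smul_def]
    push_cast
    ring
  rw [e]
  simp only [map_add, map_smul, smul_eq_mul]

end Summit.HodgeConjecture.Ring2WeilCoverage.WeilGramLevel33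

end
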